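import Mathlib
import Literature.Barriers.Parity.FordMaynardPrimeSieves

/-!
# Route `FordMaynardSieveConst01651`, target `SieveConst01651` (stmt-Parity-19185), line `sieve_decomposition`:
# helpers towards `stub_typeIIRegion` — Ford–Maynard Lemma 7.8 (i): Type-I sums along `n = d f^r`, `r ≥ 2`

K. Ford, J. Maynard, arXiv:2407.14368v1, Lemma 7.8 (p. 29), the input of the prime decomposition Lemma 7.12
(terms with a large variable that is an `r`-th power, `r ≥ 2`): if `w` satisfies (I) at level `x^γ` with exponent
`B` and `0 ≤ C ≤ B − 1`, then
`∑_{d ≤ x^γ} τ(d)^C sup_I |∑_{f ∈ I, d f ≤ x^γ} w_{d f^r}| ≪ x/(log x)^B`  (display (i), case `r ≥ 2`).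
Printed proof, followed here: bound the inner sum by `∑ |w_{d f^r}|`, write `e = d f ≤ x^γ`, `f ∣ e`,
`d f^r = e f^{r−1}`, use `τ(d) ≤ τ(e)` (`Nat.divisors_subset_of_dvd`; cf. the tree's `kfw_card_divisors_le_of_dvd`), `∑_{f ∣ e} |w_{e f^{r−1}}| ≤ τ(e) max_{f ∣ e} |w_{e f^{r−1}}|` and ONE
application of (I) with the singleton intervals `I(e) = {f_e^{r−1}}` (`f_e` a maximiser) and `τ(e)^{C+1} ≤ τ(e)^B`.
The `sup` over intervals is rendered, as in the tree's `FordMaynard.TypeI`, by an arbitrary assignment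
`d ↦ I(d) = [I(d).1, I(d).2]`; the constant is `1`. (The case `r = 1` of (i) is (I) itself; (ii), the
`log f / log x`-weighted version, is partial summation on top of (i) — not in this file.)
Def-free. Nothing here proves anything about the Parity summit.
-/

open Finset

namespace Summit.Parity.GeneralizedHardyLittlewood.FordMaynardSieveConst01651SieveConst01651

/-- **Ford–Maynard, Lemma 7.8 (i), case `r ≥ 2`.** If `w` satisfies the Type-I bound (I) at level `x^γ` with
exponent `B`, and `0 ≤ C ≤ B − 1`, then for every `r ≥ 2` and every assignment of intervals `d ↦ I(d)`,
`∑_{d ≤ x^γ} τ(d)^C |∑_{f ∈ I(d), d f ≤ x^γ, x/2 < d f^r ≤ x} w(d f^r)| ≤ x/(log x)^B`.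
[cite: FordMaynard2024PrimeSieves, Lemma 7.8 (i)] -/
theorem typeI_power_sum_le {w : ℕ → ℝ} {x γ B : ℝ}
    (hI : Literature.Barriers.Parity.FordMaynard.TypeI w x γ B) (hx : 0 ≤ x) {C : ℝ} (hC0 : 0 ≤ C)
    (hCB : C + 1 ≤ B) {r : ℕ} (hr : 2 ≤ r) (I : ℕ → ℕ × ℕ) :
    ∑ d ∈ Icc 1 ⌊x ^ γ⌋₊, ((d.divisors.card : ℝ) ^ C) *
        |∑ f ∈ (Icc (I d).1 (I d).2).filter (fun f : ℕ =>
            x / 2 < (d * f ^ r : ℝ) ∧ (d * f ^ r : ℝ) ≤ x ∧ d * f ≤ ⌊x ^ γ⌋₊), w (d * f ^ r)|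
      ≤ x / Real.log x ^ B := by
  classical
  set X : ℕ := ⌊x ^ γ⌋₊ with hX
  -- the window indicator along `e ↦ e g`
  set win : ℕ → ℕ → Prop := fun e g => x / 2 < (e * g : ℝ) ∧ (e * g : ℝ) ≤ x with hwin
  set F : ℕ → ℕ → ℝ := fun e f => |if win e (f ^ (r - 1)) then w (e * f ^ (r - 1)) else 0| with hF
  have hF0 : ∀ e f, 0 ≤ F e f := fun e f => abs_nonneg _
  -- a maximiser `f_e ∣ e` of `F e ·`
  have hmax : ∀ e : ℕ, e ≠ 0 → ∃ f ∈ e.divisors, ∀ f' ∈ e.divisors, F e f' ≤ F e f := fun e he =>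
    Finset.exists_max_image _ _ ⟨1, Nat.one_mem_divisors.mpr he⟩
  choose! fs hfsmem hfsmax using hmax
  -- STEP 1: triangle inequality and the injection `(d, f) ↦ (d f, f)`
  have hr1 : r - 1 + 1 = r := by omega
  have key_pow : ∀ d f : ℕ, d * f ^ r = d * f * f ^ (r - 1) := by
    intro d f
    conv_lhs => rw [← hr1, pow_succ']
    ring
  set P : Finset ((_ : ℕ) × ℕ) := (Icc 1 X).sigma (fun d => (Icc (I d).1 (I d).2).filter (fun f : ℕ =>
      x / 2 < (d * f ^ r : ℝ) ∧ (d * f ^ r : ℝ) ≤ x ∧ d * f ≤ X)) with hP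
  set Q : Finset ((_ : ℕ) × ℕ) := (Icc 1 X).sigma (fun e => e.divisors) with hQ
  have step1 : ∑ d ∈ Icc 1 X, ((d.divisors.card : ℝ) ^ C) *
        |∑ f ∈ (Icc (I d).1 (I d).2).filter (fun f : ℕ =>
            x / 2 < (d * f ^ r : ℝ) ∧ (d * f ^ r : ℝ) ≤ x ∧ d * f ≤ X), w (d * f ^ r)|
      ≤ ∑ p ∈ P, ((p.1.divisors.card : ℝ) ^ C) * |w (p.1 * p.2 ^ r)| := by
    rw [hP, Finset.sum_sigma]
    refine Finset.sum_le_sum fun d _ => ?_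
    dsimp only
    refine le_of_le_of_eq ?_ (Finset.mul_sum _ _ _)
    exact mul_le_mul_of_nonneg_left (Finset.abs_sum_le_sum_abs _ _) (Real.rpow_nonneg (Nat.cast_nonneg _) _)
  have hinj : Set.InjOn (fun p : (_ : ℕ) × ℕ => (⟨p.1 * p.2, p.2⟩ : (_ : ℕ) × ℕ)) (P : Set ((_ : ℕ) × ℕ)) := by
    rintro ⟨d, f⟩ hp ⟨d', f'⟩ hp' h
    simp only [Sigma.mk.injEq] at h
    obtain ⟨hdf, hff⟩ := h
    have hff' : f = f' := eq_of_heq hff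
    subst hff'
    rw [Finset.mem_coe, hP, Finset.mem_sigma, Finset.mem_filter] at hp
    have hf0 : f ≠ 0 := by
      rintro rfl
      obtain ⟨_, _, hlo, _, _⟩ := hp
      simp [zero_pow (by omega : r ≠ 0)] at hlo
      linarith [hlo]
    have : d = d' := Nat.eq_of_mul_eq_mul_right (Nat.pos_of_ne_zero hf0) hdf
    subst this
    rfl
  have hmaps : ∀ p ∈ P, (⟨p.1 * p.2, p.2⟩ : (_ : ℕ) × ℕ) ∈ Q := by
    rintro ⟨d, f⟩ hp
    rw [hP, Finset.mem_sigma, Finset.mem_filter, Finset.mem_Icc] at hp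
    obtain ⟨⟨hd1, _⟩, _, hlo, _, hdfX⟩ := hp
    dsimp only at hd1 hlo hdfX
    have hf0 : f ≠ 0 := by
      rintro rfl
      simp [zero_pow (by omega : r ≠ 0)] at hlo
      linarith [hlo]
    have hd0 : d ≠ 0 := by omega
    have hdf0 : d * f ≠ 0 := mul_ne_zero hd0 hf0
    rw [hQ, Finset.mem_sigma, Finset.mem_Icc, Nat.mem_divisors]
    dsimp only
    exact ⟨⟨Nat.one_le_iff_ne_zero.mpr hdf0, hdfX⟩, Dvd.intro_left _ rfl, hdf0⟩
  have step2 : ∑ p ∈ P, ((p.1.divisors.card : ℝ) ^ C) * |w (p.1 * p.2 ^ r)|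
      ≤ ∑ q ∈ Q, ((q.1.divisors.card : ℝ) ^ C) * F q.1 q.2 := by
    -- compare summands along the injection, then enlarge the index set
    have hle : ∀ p ∈ P, ((p.1.divisors.card : ℝ) ^ C) * |w (p.1 * p.2 ^ r)| ≤
        (((p.1 * p.2).divisors.card : ℝ) ^ C) * F (p.1 * p.2) p.2 := by
      rintro ⟨d, f⟩ hp
      rw [hP, Finset.mem_sigma, Finset.mem_filter, Finset.mem_Icc] at hp
      obtain ⟨⟨hd1, _⟩, _, hlo, hhi, _⟩ := hp
      dsimp only at hd1 hlo hhi
      have hf0 : f ≠ 0 := by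
        rintro rfl
        simp [zero_pow (by omega : r ≠ 0)] at hlo
        linarith [hlo]
      dsimp only
      have hwin : win (d * f) (f ^ (r - 1)) := by
        simp only [hwin]
        push_cast
        have : (d : ℝ) * f ^ r = (d : ℝ) * f * f ^ (r - 1) := by exact_mod_cast key_pow d f
        rw [← this]
        exact ⟨hlo, hhi⟩
      have hFe : F (d * f) f = |w (d * f ^ r)| := by
        simp only [hF, if_pos hwin, key_pow]
      rw [hFe]
      refine mul_le_mul_of_nonneg_right ?_ (abs_nonneg _)
      refine Real.rpow_le_rpow (Nat.cast_nonneg _) ?_ hC0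
      exact_mod_cast Finset.card_le_card
        (Nat.divisors_subset_of_dvd (mul_ne_zero (by omega) hf0) (Dvd.intro _ rfl))
    calc ∑ p ∈ P, ((p.1.divisors.card : ℝ) ^ C) * |w (p.1 * p.2 ^ r)|
        ≤ ∑ p ∈ P, (((p.1 * p.2).divisors.card : ℝ) ^ C) * F (p.1 * p.2) p.2 := Finset.sum_le_sum hle
      _ = ∑ q ∈ P.image (fun p : (_ : ℕ) × ℕ => (⟨p.1 * p.2, p.2⟩ : (_ : ℕ) × ℕ)),
            ((q.1.divisors.card : ℝ) ^ C) * F q.1 q.2 := by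
          rw [Finset.sum_image hinj]
      _ ≤ ∑ q ∈ Q, ((q.1.divisors.card : ℝ) ^ C) * F q.1 q.2 := by
          refine Finset.sum_le_sum_of_subset_of_nonneg ?_ fun q _ _ =>
            mul_nonneg (Real.rpow_nonneg (Nat.cast_nonneg _) _) (hF0 _ _)
          intro q hq
          rw [Finset.mem_image] at hq
          obtain ⟨p, hp, rfl⟩ := hq
          exact hmaps p hp
  -- STEP 2: `∑_{f ∣ e} F(e, f) ≤ τ(e) F(e, f_e)` and `τ(e)^{C+1} ≤ τ(e)^B`
  have step3 : ∑ q ∈ Q, ((q.1.divisors.card : ℝ) ^ C) * F q.1 q.2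
      ≤ ∑ e ∈ Icc 1 X, ((e.divisors.card : ℝ) ^ B) * F e (fs e) := by
    rw [hQ, Finset.sum_sigma]
    refine Finset.sum_le_sum fun e he => ?_
    rw [Finset.mem_Icc] at he
    have he0 : e ≠ 0 := by omega
    dsimp only
    rw [← Finset.mul_sum]
    have hτ1 : (1 : ℝ) ≤ (e.divisors.card : ℝ) := by
      exact_mod_cast Finset.card_pos.mpr ⟨1, Nat.one_mem_divisors.mpr he0⟩
    calc ((e.divisors.card : ℝ) ^ C) * ∑ f ∈ e.divisors, F e f
        ≤ ((e.divisors.card : ℝ) ^ C) * ((e.divisors.card : ℝ) * F e (fs e)) := by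
          refine mul_le_mul_of_nonneg_left ?_ (Real.rpow_nonneg (Nat.cast_nonneg _) _)
          calc ∑ f ∈ e.divisors, F e f ≤ ∑ _f ∈ e.divisors, F e (fs e) :=
                Finset.sum_le_sum fun f hf => hfsmax e he0 f hf
            _ = (e.divisors.card : ℝ) * F e (fs e) := by rw [Finset.sum_const, nsmul_eq_mul]
      _ = ((e.divisors.card : ℝ) ^ (C + 1)) * F e (fs e) := by
          rw [Real.rpow_add (by linarith), Real.rpow_one]; ring
      _ ≤ ((e.divisors.card : ℝ) ^ B) * F e (fs e) :=
          mul_le_mul_of_nonneg_right (Real.rpow_le_rpow_of_exponent_le hτ1 hCB) (hF0 _ _)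
  -- STEP 3: one application of (I) with the singleton intervals `{f_e^{r-1}}`
  have step4 : ∑ e ∈ Icc 1 X, ((e.divisors.card : ℝ) ^ B) * F e (fs e) ≤ x / Real.log x ^ B := by
    have h := hI (fun e => (fs e ^ (r - 1), fs e ^ (r - 1)))
    refine le_trans (le_of_eq ?_) h
    refine Finset.sum_congr rfl fun e _ => ?_
    congr 1
    dsimp only
    rw [Finset.Icc_self, Finset.filter_singleton]
    simp only [hF, hwin]
    split_ifs with h1
    · rw [Finset.sum_singleton]
    · rw [Finset.sum_empty]
  exact step1.trans (step2.trans (step3.trans step4))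

end Summit.Parity.GeneralizedHardyLittlewood.FordMaynardSieveConst01651SieveConst01651

namespace Summit.Parity.GeneralizedHardyLittlewood.FordMaynardSieveConst01651SieveConst01651

/-! ### Appended: the absolute-value core of Lemma 7.8 (i) and the weighted form used in Lemma 7.12 -/

/-- **The core of Lemma 7.8 (i), `r ≥ 2`, with absolute values inside**: under (I) at level `x^γ` with exponent
`B` and `0 ≤ C ≤ B − 1`,
`∑_{d ≤ x^γ} τ(d)^C ∑_{f : d f ≤ x^γ, x/2 < d f^r ≤ x} |w(d f^r)| ≤ x/(log x)^B`
(the printed proof bounds exactly this quantity: `e = d f`, `τ(d) ≤ τ(e)`, `∑_{f ∣ e} |w_{e f^{r−1}}| ≤ τ(e) max_f`,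
one application of (I) with singleton intervals). [cite: FordMaynard2024PrimeSieves, Lemma 7.8 (i) (proof)] -/
theorem typeI_power_abs_sum_le {w : ℕ → ℝ} {x γ B : ℝ}
    (hI : Literature.Barriers.Parity.FordMaynard.TypeI w x γ B) (hx : 0 ≤ x) {C : ℝ} (hC0 : 0 ≤ C)
    (hCB : C + 1 ≤ B) {r : ℕ} (hr : 2 ≤ r) :
    ∑ d ∈ Icc 1 ⌊x ^ γ⌋₊, ((d.divisors.card : ℝ) ^ C) *
        ∑ f ∈ (Icc 0 ⌊x ^ γ⌋₊).filter (fun f : ℕ =>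
            x / 2 < (d * f ^ r : ℝ) ∧ (d * f ^ r : ℝ) ≤ x ∧ d * f ≤ ⌊x ^ γ⌋₊), |w (d * f ^ r)|
      ≤ x / Real.log x ^ B := by
  classical
  set X : ℕ := ⌊x ^ γ⌋₊ with hX
  set win : ℕ → ℕ → Prop := fun e g => x / 2 < (e * g : ℝ) ∧ (e * g : ℝ) ≤ x with hwin
  set F : ℕ → ℕ → ℝ := fun e f => |if win e (f ^ (r - 1)) then w (e * f ^ (r - 1)) else 0| with hF
  have hF0 : ∀ e f, 0 ≤ F e f := fun e f => abs_nonneg _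
  have hmax : ∀ e : ℕ, e ≠ 0 → ∃ f ∈ e.divisors, ∀ f' ∈ e.divisors, F e f' ≤ F e f := fun e he =>
    Finset.exists_max_image _ _ ⟨1, Nat.one_mem_divisors.mpr he⟩
  choose! fs hfsmem hfsmax using hmax
  have hr1 : r - 1 + 1 = r := by omega
  have key_pow : ∀ d f : ℕ, d * f ^ r = d * f * f ^ (r - 1) := by
    intro d f
    conv_lhs => rw [← hr1, pow_succ']
    ring
  set P : Finset ((_ : ℕ) × ℕ) := (Icc 1 X).sigma (fun d => (Icc 0 X).filter (fun f : ℕ =>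
      x / 2 < (d * f ^ r : ℝ) ∧ (d * f ^ r : ℝ) ≤ x ∧ d * f ≤ X)) with hP
  set Q : Finset ((_ : ℕ) × ℕ) := (Icc 1 X).sigma (fun e => e.divisors) with hQ
  have step1 : ∑ d ∈ Icc 1 X, ((d.divisors.card : ℝ) ^ C) *
        ∑ f ∈ (Icc 0 X).filter (fun f : ℕ =>
            x / 2 < (d * f ^ r : ℝ) ∧ (d * f ^ r : ℝ) ≤ x ∧ d * f ≤ X), |w (d * f ^ r)|
      = ∑ p ∈ P, ((p.1.divisors.card : ℝ) ^ C) * |w (p.1 * p.2 ^ r)| := by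
    rw [hP, Finset.sum_sigma]
    refine Finset.sum_congr rfl fun d _ => ?_
    dsimp only
    rw [Finset.mul_sum]
  have hinj : Set.InjOn (fun p : (_ : ℕ) × ℕ => (⟨p.1 * p.2, p.2⟩ : (_ : ℕ) × ℕ)) (P : Set ((_ : ℕ) × ℕ)) := by
    rintro ⟨d, f⟩ hp ⟨d', f'⟩ hp' h
    simp only [Sigma.mk.injEq] at h
    obtain ⟨hdf, hff⟩ := h
    have hff' : f = f' := eq_of_heq hff
    subst hff'
    rw [Finset.mem_coe, hP, Finset.mem_sigma, Finset.mem_filter] at hp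
    have hf0 : f ≠ 0 := by
      rintro rfl
      obtain ⟨_, _, hlo, _, _⟩ := hp
      simp [zero_pow (by omega : r ≠ 0)] at hlo
      linarith [hlo]
    have : d = d' := Nat.eq_of_mul_eq_mul_right (Nat.pos_of_ne_zero hf0) hdf
    subst this
    rfl
  have hmaps : ∀ p ∈ P, (⟨p.1 * p.2, p.2⟩ : (_ : ℕ) × ℕ) ∈ Q := by
    rintro ⟨d, f⟩ hp
    rw [hP, Finset.mem_sigma, Finset.mem_filter, Finset.mem_Icc] at hp
    obtain ⟨⟨hd1, _⟩, _, hlo, _, hdfX⟩ := hp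
    dsimp only at hd1 hlo hdfX
    have hf0 : f ≠ 0 := by
      rintro rfl
      simp [zero_pow (by omega : r ≠ 0)] at hlo
      linarith [hlo]
    have hd0 : d ≠ 0 := by omega
    have hdf0 : d * f ≠ 0 := mul_ne_zero hd0 hf0
    rw [hQ, Finset.mem_sigma, Finset.mem_Icc, Nat.mem_divisors]
    dsimp only
    exact ⟨⟨Nat.one_le_iff_ne_zero.mpr hdf0, hdfX⟩, Dvd.intro_left _ rfl, hdf0⟩
  have step2 : ∑ p ∈ P, ((p.1.divisors.card : ℝ) ^ C) * |w (p.1 * p.2 ^ r)|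
      ≤ ∑ q ∈ Q, ((q.1.divisors.card : ℝ) ^ C) * F q.1 q.2 := by
    have hle : ∀ p ∈ P, ((p.1.divisors.card : ℝ) ^ C) * |w (p.1 * p.2 ^ r)| ≤
        (((p.1 * p.2).divisors.card : ℝ) ^ C) * F (p.1 * p.2) p.2 := by
      rintro ⟨d, f⟩ hp
      rw [hP, Finset.mem_sigma, Finset.mem_filter, Finset.mem_Icc] at hp
      obtain ⟨⟨hd1, _⟩, _, hlo, hhi, _⟩ := hp
      dsimp only at hd1 hlo hhi
      have hf0 : f ≠ 0 := by
        rintro rfl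
        simp [zero_pow (by omega : r ≠ 0)] at hlo
        linarith [hlo]
      dsimp only
      have hwin : win (d * f) (f ^ (r - 1)) := by
        simp only [hwin]
        push_cast
        have : (d : ℝ) * f ^ r = (d : ℝ) * f * f ^ (r - 1) := by exact_mod_cast key_pow d f
        rw [← this]
        exact ⟨hlo, hhi⟩
      have hFe : F (d * f) f = |w (d * f ^ r)| := by
        simp only [hF, if_pos hwin, key_pow]
      rw [hFe]
      refine mul_le_mul_of_nonneg_right ?_ (abs_nonneg _)
      refine Real.rpow_le_rpow (Nat.cast_nonneg _) ?_ hC0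
      exact_mod_cast Finset.card_le_card
        (Nat.divisors_subset_of_dvd (mul_ne_zero (by omega) hf0) (Dvd.intro _ rfl))
    calc ∑ p ∈ P, ((p.1.divisors.card : ℝ) ^ C) * |w (p.1 * p.2 ^ r)|
        ≤ ∑ p ∈ P, (((p.1 * p.2).divisors.card : ℝ) ^ C) * F (p.1 * p.2) p.2 := Finset.sum_le_sum hle
      _ = ∑ q ∈ P.image (fun p : (_ : ℕ) × ℕ => (⟨p.1 * p.2, p.2⟩ : (_ : ℕ) × ℕ)),
            ((q.1.divisors.card : ℝ) ^ C) * F q.1 q.2 := by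
          rw [Finset.sum_image hinj]
      _ ≤ ∑ q ∈ Q, ((q.1.divisors.card : ℝ) ^ C) * F q.1 q.2 := by
          refine Finset.sum_le_sum_of_subset_of_nonneg ?_ fun q _ _ =>
            mul_nonneg (Real.rpow_nonneg (Nat.cast_nonneg _) _) (hF0 _ _)
          intro q hq
          rw [Finset.mem_image] at hq
          obtain ⟨p, hp, rfl⟩ := hq
          exact hmaps p hp
  have step3 : ∑ q ∈ Q, ((q.1.divisors.card : ℝ) ^ C) * F q.1 q.2
      ≤ ∑ e ∈ Icc 1 X, ((e.divisors.card : ℝ) ^ B) * F e (fs e) := by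
    rw [hQ, Finset.sum_sigma]
    refine Finset.sum_le_sum fun e he => ?_
    rw [Finset.mem_Icc] at he
    have he0 : e ≠ 0 := by omega
    dsimp only
    rw [← Finset.mul_sum]
    have hτ1 : (1 : ℝ) ≤ (e.divisors.card : ℝ) := by
      exact_mod_cast Finset.card_pos.mpr ⟨1, Nat.one_mem_divisors.mpr he0⟩
    calc ((e.divisors.card : ℝ) ^ C) * ∑ f ∈ e.divisors, F e f
        ≤ ((e.divisors.card : ℝ) ^ C) * ((e.divisors.card : ℝ) * F e (fs e)) := by
          refine mul_le_mul_of_nonneg_left ?_ (Real.rpow_nonneg (Nat.cast_nonneg _) _)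
          calc ∑ f ∈ e.divisors, F e f ≤ ∑ _f ∈ e.divisors, F e (fs e) :=
                Finset.sum_le_sum fun f hf => hfsmax e he0 f hf
            _ = (e.divisors.card : ℝ) * F e (fs e) := by rw [Finset.sum_const, nsmul_eq_mul]
      _ = ((e.divisors.card : ℝ) ^ (C + 1)) * F e (fs e) := by
          rw [Real.rpow_add (by linarith), Real.rpow_one]; ring
      _ ≤ ((e.divisors.card : ℝ) ^ B) * F e (fs e) :=
          mul_le_mul_of_nonneg_right (Real.rpow_le_rpow_of_exponent_le hτ1 hCB) (hF0 _ _)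
  have step4 : ∑ e ∈ Icc 1 X, ((e.divisors.card : ℝ) ^ B) * F e (fs e) ≤ x / Real.log x ^ B := by
    have h := hI (fun e => (fs e ^ (r - 1), fs e ^ (r - 1)))
    refine le_trans (le_of_eq ?_) h
    refine Finset.sum_congr rfl fun e _ => ?_
    congr 1
    dsimp only
    rw [Finset.Icc_self, Finset.filter_singleton]
    simp only [hF, hwin]
    split_ifs with h1
    · rw [Finset.sum_singleton]
    · rw [Finset.sum_empty]
  exact (le_of_eq step1).trans (step2.trans (step3.trans step4))

/-- **Lemma 7.8 (i)/(ii), `r ≥ 2`, with an arbitrary `1`-bounded weight** (the form consumed by Lemma 7.12, where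
the weight is `λ_f ∈ {1, log f / log x}`): under (I) with exponent `B`, `0 ≤ C ≤ B − 1`, for every assignment of
intervals `d ↦ I(d)` and weights `|c_d(f)| ≤ 1`,
`∑_{d ≤ x^γ} τ(d)^C |∑_{f ∈ I(d), d f ≤ x^γ, x/2 < d f^r ≤ x} w(d f^r) c_d(f)| ≤ x/(log x)^B`.
[cite: FordMaynard2024PrimeSieves, Lemma 7.8 (i)–(ii), case r ≥ 2] -/
theorem typeI_power_weight_sum_le {w : ℕ → ℝ} {x γ B : ℝ}
    (hI : Literature.Barriers.Parity.FordMaynard.TypeI w x γ B) (hx : 0 ≤ x) {C : ℝ} (hC0 : 0 ≤ C)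
    (hCB : C + 1 ≤ B) {r : ℕ} (hr : 2 ≤ r) (c : ℕ → ℕ → ℝ) (hc : ∀ d f, |c d f| ≤ 1) (I : ℕ → ℕ × ℕ) :
    ∑ d ∈ Icc 1 ⌊x ^ γ⌋₊, ((d.divisors.card : ℝ) ^ C) *
        |∑ f ∈ (Icc (I d).1 (I d).2).filter (fun f : ℕ =>
            x / 2 < (d * f ^ r : ℝ) ∧ (d * f ^ r : ℝ) ≤ x ∧ d * f ≤ ⌊x ^ γ⌋₊), w (d * f ^ r) * c d f|
      ≤ x / Real.log x ^ B := by
  refine le_trans (Finset.sum_le_sum fun d hd => ?_) (typeI_power_abs_sum_le hI hx hC0 hCB hr)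
  rw [Finset.mem_Icc] at hd
  refine mul_le_mul_of_nonneg_left ?_ (Real.rpow_nonneg (Nat.cast_nonneg _) _)
  calc |∑ f ∈ (Icc (I d).1 (I d).2).filter (fun f : ℕ =>
            x / 2 < (d * f ^ r : ℝ) ∧ (d * f ^ r : ℝ) ≤ x ∧ d * f ≤ ⌊x ^ γ⌋₊), w (d * f ^ r) * c d f|
      ≤ ∑ f ∈ (Icc (I d).1 (I d).2).filter (fun f : ℕ =>
            x / 2 < (d * f ^ r : ℝ) ∧ (d * f ^ r : ℝ) ≤ x ∧ d * f ≤ ⌊x ^ γ⌋₊), |w (d * f ^ r)| := by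
        refine (Finset.abs_sum_le_sum_abs _ _).trans (Finset.sum_le_sum fun f _ => ?_)
        rw [abs_mul]
        exact mul_le_of_le_one_right (abs_nonneg _) (hc d f)
    _ ≤ ∑ f ∈ (Icc 0 ⌊x ^ γ⌋₊).filter (fun f : ℕ =>
            x / 2 < (d * f ^ r : ℝ) ∧ (d * f ^ r : ℝ) ≤ x ∧ d * f ≤ ⌊x ^ γ⌋₊), |w (d * f ^ r)| := by
        refine Finset.sum_le_sum_of_subset_of_nonneg ?_ fun f _ _ => abs_nonneg _
        intro f hf
        rw [Finset.mem_filter] at hf ⊢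
        refine ⟨Finset.mem_Icc.mpr ⟨Nat.zero_le _, ?_⟩, hf.2⟩
        calc f ≤ d * f := Nat.le_mul_of_pos_left f (by omega)
          _ ≤ ⌊x ^ γ⌋₊ := hf.2.2.2

end Summit.Parity.GeneralizedHardyLittlewood.FordMaynardSieveConst01651SieveConst01651
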